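/-
Copyright: lit-balaban Phase-2 proof seat p33 (gen 8).  Statement-level skeleton of a published paper; no proof claims beyond what
the kernel checks below.
-/
import Literature.MathematicalPhysics.QuantumFieldTheory.BalabanImbrieJaffe1984to88.BIJ85Ineq732Flat

/-!
# [BalabanImbrieJaffe1985] §7.3, the propagators of `Δ_k(u_k)`: THE AGMON–COMBES–THOMAS CONJUGATION DEFECTS of `‖D_uφ‖²` and
# `‖Q_k(u)φ‖²` on the torus carrier of record (kernel file 1 of 3 of the decay of `G_k(u) = [D_u^*D_u + a_kQ_k(u)^*Q_k(u)]⁻¹`)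

T. Bałaban, J. Imbrie, A. Jaffe, *Renormalization of the Higgs model: minimizers, propagators and the stability of mean field theory*,
Commun. Math. Phys. **97** (1985) 299–329 [BalabanImbrieJaffe1985].  Row **C1.Eq7.3.1-7.3.2** of the lit-balaban skeleton (owner r15),
the p. 326 sentence on the scalar propagators.

statement-level skeleton of published theorems with citation tags; proofs where landed; nothing here is a claim about the Yang–Mills mass gap

PDF held: `paper:balaban1985-cmp97-bij-higgs-minimizers` (p. 326 = PDF 28; p. 313 = PDF 15); text layer re-read this session.

THE PRINTED TEXT, verbatim, p. 326 [PDF 28]: *"These inequalities can be proved by an extension of the proofs of [7]. The propagators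
arising from Δ_k(u_k), under the restriction (7.3.1) on the gauge field, also satisfy the regularity and decay estimates of [7]. In order to
remain within the framework of this reference, we remark that by change of gauge u_k can be transformed in a local region Λ into a
configuration of the form exp[ie_kηA], where A is smooth and small."*; p. 313 [PDF 15]: *"G_k(u_k) = [−Δ_{u_k} + a_kQ_k^*(u_k)Q_k(u_k)]^{−1},
(4.6.2) where −Δ_{u_k} = D^*_{u_k}D_{u_k}. (4.6.3)"*.  [7] = [Balaban1983RegularityDecay] (cell paper B4), whose decay statement for these
propagators is Cor. 2.3 (2.30) p. 580: `|⟨f, G_k(Ω,A)f′⟩| ≤ c₀e^{−δ₀dist(supp f, supp f′)}‖f‖₂‖f′‖₂`.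

WHAT THIS FILE PROVES — the two quadratic-form identities behind an energy-method (Agmon / Combes–Thomas conjugation) proof of that
DECAY for the torus operator of record `T = D_u^*D_u + aQ_k(u)^*Q_k(u)` (p30/p11: `BIJ85ScalarForm464.opT (Dlin c U) (QlinK U k) a`):
for a real site weight `ω` (the multiplication operator `wmul ω`, the one definition of this file) and any fine field `φ`,
* §1 `rankOne_defect_le` (private, [folklore]): for a rank-one form `|Σ_i α_iφ_i|²` over a finite set with `(ω_i − ω_{i′})² ≤ S·ω_iω_{i′}`:
  `|Σα ωφ|² − Re(conj(Σαφ)·Σαω²φ) ≤ (S/2)(Σ|α|)(Σ|α|(ω|φ|)²)` — the discrete IMS/ground-state identity `= −½ΣΣ Re(ᾱφ̄ α′φ′)(ω − ω′)²`,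
  SECOND ORDER in the oscillation of the weight (first order would lose the uniformity in the lattice spacing);
* §2 **`defect_D_le`**: `‖D_u(ωφ)‖² − ⟨D_uφ, D_u(ω²φ)⟩ ≤ 2d·c²·S₁·‖ωφ‖²` when `(ω(b₊) − ω(b₋))² ≤ S₁ω(b₊)ω(b₋)` on every η-bond
  (the bond term is the rank-one form of `(cu_b, −c)`; EVERY `U(1)` field `u`, unit-modulus transports);
* §3 **`defect_Q_le`**: `‖Q_k(u)(ωφ)‖² − ⟨Q_k(u)φ, Q_k(u)(ω²φ)⟩ ≤ (S₂/2)·N⁻¹·‖ωφ‖²` when `(ω(x) − ω(x′))² ≤ S₂ω(x)ω(x′)` inside every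
  `k`-block (`N = L^{kd}`; the covariant average `qCovK` of record is the rank-one form with coefficients `N⁻¹u(Γ^{(k)}_{x_k,x})` of modulus
  `N⁻¹`; blocks partition the torus).
The assembly (coercivity from p11's covariant Poincaré inequality, the weighted resolvent bound, the exponential weight in the block distance,
the physical constants and the (7.3.1) corollary) is in the sibling files `BIJ85ScalarPropagatorDecay` / `BIJ85Claim73PropagatorDecay`.
HONEST SCOPE.  DIVERGENCE OF METHOD, disclosed: the print defers to [7]'s random-walk / Cor. 2.3 route via a local change of gauge; the energy
(Agmon) route below reaches the same SHAPE of statement ((2.30): exponential decay of the `L²` pairing in the distance of the supports,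
uniformly in the lattice spacing) for the torus operator of record, with our own explicit constants; it gives the DECAY member only — no
pointwise/Hölder REGULARITY member of [7]'s estimates is claimed.  Kernel lemmas are [folklore] finite-dimensional algebra.  Nothing here is
summit progress.  Unit `lit-balaban-p33` (literature-prover-lit-balaban-p33-g8-0), HOME `run/shared/lean/pub/lit-balaban/`, 2026-08-21.
-/

open scoped RealInnerProductSpace BigOperators ComplexConjugate
open Finset

namespace Literature.MathematicalPhysics.QuantumFieldTheory.BalabanImbrieJaffe1984to88.BIJ85AgmonDefect

open Literature.MathematicalPhysics.QuantumFieldTheory.Balaban1983to89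
open BIJ88Sect3Statements (U1 toC toC_one toC_mul norm_toC cfg covD)
open BIJ85Sect1Model (HiggsField)
open BIJ85BlockAveragesTorus BIJ85BlockAveragesTorusK BIJ85ScalarPropagatorTorus BIJ85ScalarPropagatorTorusK
open BIJ85BlockAveragingIneq BIJ85Ineq732Flat

noncomputable section

variable {P : Params} {j : ℕ}

/-! ## §0 Bookkeeping: the weight operator and real inner products of `ℂ`-valued fields -/

/-- kernel: `‖z‖² = Re(z̄z)`. [folklore] -/
private theorem norm_sq_eq_re (z : ℂ) : ‖z‖ ^ 2 = (conj z * z).re := by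
  rw [Complex.conj_mul']; norm_cast

/-- kernel: the real inner product of two `ℂ`-valued `ℓ²` fields is `Σ_x Re(f̄(x)g(x))` (the real part of (2.2)). [cite: BalabanImbrieJaffe1985, (2.2) p.302] -/
theorem inner_eq_re_sum {ι : Type*} [Fintype ι] (f g : PiLp 2 (fun _ : ι => ℂ)) :
    ⟪f, g⟫ = ∑ x, (conj (f x) * g x).re := by
  rw [PiLp.inner_apply]
  exact sum_congr rfl fun x _ => by rw [Complex.inner, mul_comm]

/-- **The weight operator** `φ ↦ ωφ` (multiplication by a real function of the η-lattice site) on the fine scalar fields of (4.6.1) — the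
conjugation `e^{ρ}` of the Agmon / Combes–Thomas method for the propagators of p. 326. [cite: BalabanImbrieJaffe1985, (4.6.2) p.313] -/
def wmul (ω : Balaban1983to89.Site P j → ℝ) : FineSp P j →ₗ[ℝ] FineSp P j where
  toFun φ := WithLp.toLp 2 fun x => (ω x : ℂ) * φ x
  map_add' φ φ' := by ext x; simp only [PiLp.add_apply, mul_add]
  map_smul' r φ := by ext x; simp only [PiLp.smul_apply, RingHom.id_apply, Complex.real_smul]; ring

/-- kernel: `(ωφ)(x) = ω(x)φ(x)`. [cite: BalabanImbrieJaffe1985, (4.6.2) p.313] -/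
@[simp] theorem wmul_apply (ω : Balaban1983to89.Site P j → ℝ) (φ : FineSp P j) (x : Balaban1983to89.Site P j) :
    wmul ω φ x = (ω x : ℂ) * φ x := rfl

/-- kernel: weights compose multiplicatively, `ω(ω′φ) = (ωω′)φ`. [cite: BalabanImbrieJaffe1985, (4.6.2) p.313] -/
theorem wmul_wmul (ω ω' : Balaban1983to89.Site P j → ℝ) (φ : FineSp P j) :
    wmul ω (wmul ω' φ) = wmul (fun x => ω x * ω' x) φ := by
  ext x; simp only [wmul_apply, Complex.ofReal_mul]; ring

/-- kernel: the unit weight is the identity. [cite: BalabanImbrieJaffe1985, (4.6.2) p.313] -/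
theorem wmul_one' (φ : FineSp P j) : wmul (fun _ => (1 : ℝ)) φ = φ := by
  ext x; rw [wmul_apply, Complex.ofReal_one, one_mul]

/-- kernel: a real weight is symmetric for the real inner product (2.2). [cite: BalabanImbrieJaffe1985, (2.2) p.302] -/
theorem inner_wmul_comm (ω : Balaban1983to89.Site P j → ℝ) (f g : FineSp P j) :
    ⟪wmul ω f, g⟫ = ⟪f, wmul ω g⟫ := by
  rw [inner_eq_re_sum, inner_eq_re_sum]
  refine sum_congr rfl fun x _ => ?_
  rw [wmul_apply, wmul_apply, map_mul, Complex.conj_ofReal]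
  ring_nf

/-- kernel: `‖ωφ‖² = Σ_x (ω(x)|φ(x)|)²` in the `ℓ²` product (2.2). [cite: BalabanImbrieJaffe1985, (2.2) p.302] -/
theorem norm_wmul_sq (ω : Balaban1983to89.Site P j → ℝ) (φ : FineSp P j) :
    ‖wmul ω φ‖ ^ 2 = ∑ x, (ω x * ‖φ x‖) ^ 2 := by
  rw [← sum_norm_sq_eq]
  refine sum_congr rfl fun x _ => ?_
  rw [wmul_apply, norm_mul, Complex.norm_real, Real.norm_eq_abs, mul_pow, mul_pow, sq_abs]

/-- kernel: a weight bounded by `C` on the support of `φ` costs at most `C` in the `ℓ²` norm (2.2). [cite: BalabanImbrieJaffe1985, (2.2) p.302] -/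
theorem norm_wmul_le {ω : Balaban1983to89.Site P j → ℝ} {C : ℝ} (hC : 0 ≤ C) (φ : FineSp P j)
    (h : ∀ x, φ x ≠ 0 → |ω x| ≤ C) : ‖wmul ω φ‖ ≤ C * ‖φ‖ := by
  have h2 : ‖wmul ω φ‖ ^ 2 ≤ (C * ‖φ‖) ^ 2 := by
    rw [norm_wmul_sq, mul_pow, ← sum_norm_sq_eq, mul_sum]
    refine sum_le_sum fun x _ => ?_
    by_cases hx : φ x = 0
    · simp [hx]
    · rw [mul_pow, ← sq_abs (ω x)]
      exact mul_le_mul_of_nonneg_right (pow_le_pow_left₀ (abs_nonneg _) (h x hx) 2) (sq_nonneg _)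
  exact le_of_sq_le_sq (by rwa [pow_two, pow_two] at h2 ⊢) (by positivity)

/-! ## §1 The rank-one conjugation defect (discrete IMS identity) -/

/-- kernel: `(e^a − e^b)² ≤ (a − b)²e^{|a−b|}·e^ae^b` when `b ≤ a` (from `e^δ − 1 ≤ δe^δ`). [folklore] -/
private theorem sq_exp_sub_exp_le_of_le {a b : ℝ} (hab : b ≤ a) :
    (Real.exp a - Real.exp b) ^ 2 ≤ (a - b) ^ 2 * Real.exp |a - b| * (Real.exp a * Real.exp b) := by
  obtain ⟨δ, hδ0, rfl⟩ : ∃ δ, 0 ≤ δ ∧ a = b + δ := ⟨a - b, by linarith, by ring⟩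
  rw [add_sub_cancel_left, abs_of_nonneg hδ0, Real.exp_add]
  have h1 := Real.add_one_le_exp (-δ)
  have h2 : Real.exp (-δ) * Real.exp δ = 1 := by rw [← Real.exp_add, neg_add_cancel, Real.exp_zero]
  have hd := Real.exp_pos δ
  have h3 : Real.exp δ - 1 ≤ δ * Real.exp δ := by nlinarith
  have h4 : 0 ≤ Real.exp δ - 1 := by linarith [Real.add_one_le_exp δ]
  have hb := Real.exp_pos b
  calc (Real.exp b * Real.exp δ - Real.exp b) ^ 2 = Real.exp b ^ 2 * (Real.exp δ - 1) ^ 2 := by ring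
    _ ≤ Real.exp b ^ 2 * (δ * Real.exp δ) ^ 2 := by gcongr
    _ = δ ^ 2 * Real.exp δ * (Real.exp b * Real.exp δ * Real.exp b) := by ring

/-- kernel: the oscillation of an exponential weight, `(e^a − e^b)² ≤ (a − b)²e^{|a−b|}·e^ae^b`. [folklore] -/
private theorem sq_exp_sub_exp_le (a b : ℝ) :
    (Real.exp a - Real.exp b) ^ 2 ≤ (a - b) ^ 2 * Real.exp |a - b| * (Real.exp a * Real.exp b) := by
  rcases le_total b a with hab | hab
  · exact sq_exp_sub_exp_le_of_le hab
  · have h := sq_exp_sub_exp_le_of_le hab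
    calc (Real.exp a - Real.exp b) ^ 2 = (Real.exp b - Real.exp a) ^ 2 := by ring
      _ ≤ (b - a) ^ 2 * Real.exp |b - a| * (Real.exp b * Real.exp a) := h
      _ = (a - b) ^ 2 * Real.exp |a - b| * (Real.exp a * Real.exp b) := by rw [abs_sub_comm]; ring

/-- kernel: the oscillation of the Agmon weight `e^{ρ}` between two points at `ρ`-distance `≤ δ`:
`(e^{ρ} − e^{ρ′})² ≤ δ²e^{δ}·e^{ρ}e^{ρ′}` — the smallness that makes the conjugated operator a small perturbation (the p. 326 decay mechanism
in its energy form). [cite: BalabanImbrieJaffe1985, (7.3.2) p.326] -/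
theorem sq_exp_sub_exp_le_of_abs_le {a b δ : ℝ} (h : |a - b| ≤ δ) :
    (Real.exp a - Real.exp b) ^ 2 ≤ δ ^ 2 * Real.exp δ * (Real.exp a * Real.exp b) := by
  refine (sq_exp_sub_exp_le a b).trans ?_
  have h1 : (a - b) ^ 2 ≤ δ ^ 2 := by rw [← sq_abs]; exact pow_le_pow_left₀ (abs_nonneg _) h 2
  have h2 : Real.exp |a - b| ≤ Real.exp δ := Real.exp_le_exp.2 h
  have := Real.exp_pos |a - b|
  have := Real.exp_pos a
  have := Real.exp_pos b
  gcongr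

/-- **THE RANK-ONE CONJUGATION DEFECT** (discrete IMS / ground-state identity): for complex coefficients `α`, a field `φ` and a real weight `ω` on
a finite set with `(ω_i − ω_{i′})² ≤ S·ω_iω_{i′}` (`S ≥ 0`):
`|Σ_i α_iω_iφ_i|² − Re(conj(Σ_i α_iφ_i)·Σ_i α_iω_i²φ_i) ≤ (S/2)·(Σ_i|α_i|)·Σ_i|α_i|(ω_i|φ_i|)²` — the left side equals `−½Σ_{i,i′}Re(conj(α_iφ_i)α_{i′}φ_{i′})(ω_i − ω_{i′})²`
(symmetrisation), each pair is bounded by `S·|α_iφ_i|ω_i·|α_{i′}φ_{i′}|ω_{i′}`, then Cauchy–Schwarz. [folklore] -/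
private theorem rankOne_defect_le {ι : Type*} (s : Finset ι) (α φ : ι → ℂ) (ω : ι → ℝ) {S : ℝ} (hS : 0 ≤ S)
    (hω : ∀ i ∈ s, ∀ i' ∈ s, (ω i - ω i') ^ 2 ≤ S * (ω i * ω i')) :
    ‖∑ i ∈ s, α i * ((ω i : ℂ) * φ i)‖ ^ 2
        - (conj (∑ i ∈ s, α i * φ i) * ∑ i ∈ s, α i * (((ω i : ℂ)) ^ 2 * φ i)).re
      ≤ S / 2 * (∑ i ∈ s, ‖α i‖) * ∑ i ∈ s, ‖α i‖ * (ω i * ‖φ i‖) ^ 2 := by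
  -- the pair terms
  set z : ι → ι → ℂ := fun i i' => conj (α i * φ i) * (α i' * φ i') with hz
  have hzsymm : ∀ i i', (z i' i).re = (z i i').re := by
    intro i i'
    have : z i' i = conj (z i i') := by simp only [hz, map_mul, Complex.conj_conj]; ring
    rw [this, Complex.conj_re]
  have hznorm : ∀ i i', ‖z i i'‖ = ‖α i‖ * ‖φ i‖ * (‖α i'‖ * ‖φ i'‖) := by
    intro i i'; simp only [hz, norm_mul, Complex.norm_conj]
  -- the three double sums
  set A : ℝ := ∑ i ∈ s, ∑ i' ∈ s, (z i i').re * (ω i * ω i') with hA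
  set B : ℝ := ∑ i ∈ s, ∑ i' ∈ s, (z i i').re * (ω i') ^ 2 with hB
  set B' : ℝ := ∑ i ∈ s, ∑ i' ∈ s, (z i i').re * (ω i) ^ 2 with hB'
  set C : ℝ := ∑ i ∈ s, ∑ i' ∈ s, (z i i').re * (ω i - ω i') ^ 2 with hC
  have h1 : ‖∑ i ∈ s, α i * ((ω i : ℂ) * φ i)‖ ^ 2 = A := by
    rw [norm_sq_eq_re, map_sum, Finset.sum_mul_sum, Complex.re_sum, hA]
    refine Finset.sum_congr rfl fun i _ => ?_
    rw [Complex.re_sum]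
    refine Finset.sum_congr rfl fun i' _ => ?_
    have : conj (α i * ((ω i : ℂ) * φ i)) * (α i' * ((ω i' : ℂ) * φ i')) = z i i' * ((ω i * ω i' : ℝ) : ℂ) := by
      simp only [hz, map_mul, Complex.conj_ofReal, Complex.ofReal_mul]; ring
    rw [this, Complex.re_mul_ofReal]
  have h2 : (conj (∑ i ∈ s, α i * φ i) * ∑ i ∈ s, α i * (((ω i : ℂ)) ^ 2 * φ i)).re = B := by
    rw [map_sum, Finset.sum_mul_sum, Complex.re_sum, hB]
    refine Finset.sum_congr rfl fun i _ => ?_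
    rw [Complex.re_sum]
    refine Finset.sum_congr rfl fun i' _ => ?_
    have : conj (α i * φ i) * (α i' * ((ω i' : ℂ) ^ 2 * φ i')) = z i i' * (((ω i') ^ 2 : ℝ) : ℂ) := by
      simp only [hz, Complex.ofReal_pow]; ring
    rw [this, Complex.re_mul_ofReal]
  have hBB' : B = B' := by
    rw [hB, hB', Finset.sum_comm]
    exact Finset.sum_congr rfl fun i _ => Finset.sum_congr rfl fun i' _ => by rw [hzsymm]
  have hCexp : C = B' - 2 * A + B := by
    rw [hC, hA, hB, hB', Finset.mul_sum, ← Finset.sum_sub_distrib, ← Finset.sum_add_distrib]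
    refine Finset.sum_congr rfl fun i _ => ?_
    rw [Finset.mul_sum, ← Finset.sum_sub_distrib, ← Finset.sum_add_distrib]
    refine Finset.sum_congr rfl fun i' _ => ?_
    ring
  have h3 : A - B = -(1 / 2) * C := by rw [hCexp, hBB']; ring
  rw [h1, h2, h3]
  -- bound the pair terms
  set av : ι → ℝ := fun i => ‖α i‖ * ‖φ i‖ * ω i with hav
  have h4 : ∀ i ∈ s, ∀ i' ∈ s, -((z i i').re * (ω i - ω i') ^ 2) ≤ S * (av i * av i') := by
    intro i hi i' hi'
    have hre : -(z i i').re ≤ ‖z i i'‖ := by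
      have := Complex.abs_re_le_norm (z i i'); have := neg_abs_le (z i i').re; linarith
    calc -((z i i').re * (ω i - ω i') ^ 2) = (-(z i i').re) * (ω i - ω i') ^ 2 := by ring
      _ ≤ ‖z i i'‖ * (S * (ω i * ω i')) :=
          mul_le_mul hre (hω i hi i' hi') (sq_nonneg _) (norm_nonneg _)
      _ = _ := by rw [hznorm, hav]; ring
  have h5 : -C ≤ S * (∑ i ∈ s, av i) ^ 2 :=
    calc -C = ∑ i ∈ s, ∑ i' ∈ s, -((z i i').re * (ω i - ω i') ^ 2) := by
          rw [hC, ← Finset.sum_neg_distrib]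
          exact Finset.sum_congr rfl fun i _ => by rw [Finset.sum_neg_distrib]
      _ ≤ ∑ i ∈ s, ∑ i' ∈ s, S * (av i * av i') :=
          Finset.sum_le_sum fun i hi => Finset.sum_le_sum fun i' hi' => h4 i hi i' hi'
      _ = S * (∑ i ∈ s, av i) ^ 2 := by
          rw [show (∑ i ∈ s, av i) ^ 2 = (∑ i ∈ s, av i) * ∑ i ∈ s, av i from sq _, Finset.sum_mul_sum,
            Finset.mul_sum]
          exact Finset.sum_congr rfl fun i _ => by rw [Finset.mul_sum]
  -- Cauchy–Schwarz
  have hcs := Finset.sum_mul_sq_le_sq_mul_sq s (fun i => Real.sqrt ‖α i‖) (fun i => Real.sqrt ‖α i‖ * (ω i * ‖φ i‖))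
  have e1 : ∀ i, Real.sqrt ‖α i‖ * (Real.sqrt ‖α i‖ * (ω i * ‖φ i‖)) = av i := by
    intro i; rw [← mul_assoc, Real.mul_self_sqrt (norm_nonneg _), hav]; ring
  have e2 : ∀ i, Real.sqrt ‖α i‖ ^ 2 = ‖α i‖ := fun i => Real.sq_sqrt (norm_nonneg _)
  have e3 : ∀ i, (Real.sqrt ‖α i‖ * (ω i * ‖φ i‖)) ^ 2 = ‖α i‖ * (ω i * ‖φ i‖) ^ 2 := by
    intro i; rw [mul_pow, e2]
  simp only [e1, e2, e3] at hcs
  have hσ : 0 ≤ S / 2 := by positivity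
  calc -(1 / 2) * C = (1 / 2) * (-C) := by ring
    _ ≤ (1 / 2) * (S * (∑ i ∈ s, av i) ^ 2) := by gcongr
    _ = S / 2 * (∑ i ∈ s, av i) ^ 2 := by ring
    _ ≤ S / 2 * ((∑ i ∈ s, ‖α i‖) * ∑ i ∈ s, ‖α i‖ * (ω i * ‖φ i‖) ^ 2) :=
        mul_le_mul_of_nonneg_left hcs hσ
    _ = _ := by ring


/-! ## §2 The conjugation defect of the covariant bond term -/

/-- kernel: on one η-bond the weighted covariant difference `c(u_bω(b₊)φ(b₊) − ω(b₋)φ(b₋))` is the rank-one sum over `Bool` with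
coefficients `(cu_b, −c)`. [cite: BalabanImbrieJaffe1985, (4.6.3) p.313] -/
theorem covD_wmul_eq_sum (c : ℝ) (U : GaugeField P j U1) (ω : Balaban1983to89.Site P j → ℝ) (φ : FineSp P j)
    (b : PBond P j) :
    covD c (cfg U) (WithLp.ofLp (wmul ω φ)) b
      = ∑ i : Bool, (bif i then (c : ℂ) * toC (U b) else -(c : ℂ)) *
          (((bif i then ω b.tgt else ω b.src : ℝ) : ℂ) * (bif i then φ b.tgt else φ b.src)) := by
  rw [Fintype.sum_bool]
  simp only [cond_true, cond_false, covD, cfg]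
  show (c : ℂ) * (toC (U b) * ((ω b.tgt : ℂ) * φ b.tgt) - (ω b.src : ℂ) * φ b.src) = _
  ring

/-- **THE CONJUGATION DEFECT OF THE COVARIANT KINETIC TERM `‖D_uφ‖²` of (4.6.3)** (every `U(1)` field `u`, normalization `c`): if
`(ω(b₊) − ω(b₋))² ≤ S₁ω(b₊)ω(b₋)` on every η-bond then `‖D_u(ωφ)‖² − ⟨D_uφ, D_u(ω²φ)⟩ ≤ 2d·c²S₁·‖ωφ‖²` — §1 per bond (`Σ|α| = 2|c|`), then
every site is the initial point of `d` bonds and the end point of `d` bonds. [cite: BalabanImbrieJaffe1985, (4.6.3) p.313] -/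
theorem defect_D_le (c : ℝ) (U : GaugeField P j U1) {ω : Balaban1983to89.Site P j → ℝ} {S₁ : ℝ} (hS₁ : 0 ≤ S₁)
    (hω : ∀ b : PBond P j, (ω b.tgt - ω b.src) ^ 2 ≤ S₁ * (ω b.tgt * ω b.src)) (φ : FineSp P j) :
    ‖Dlin c U (wmul ω φ)‖ ^ 2 - ⟪Dlin c U φ, Dlin c U (wmul ω (wmul ω φ))⟫
      ≤ 2 * P.d * c ^ 2 * S₁ * ‖wmul ω φ‖ ^ 2 := by
  -- both sides as sums over bonds
  rw [PiLp.norm_sq_eq_of_L2, inner_eq_re_sum, ← Finset.sum_sub_distrib]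
  have hb : ∀ b : PBond P j,
      ‖Dlin c U (wmul ω φ) b‖ ^ 2 - (conj (Dlin c U φ b) * Dlin c U (wmul ω (wmul ω φ)) b).re
        ≤ c ^ 2 * S₁ * ((ω b.tgt * ‖φ b.tgt‖) ^ 2 + (ω b.src * ‖φ b.src‖) ^ 2) := by
    intro b
    -- the three covariant differences as rank-one sums over `Bool`
    set α : Bool → ℂ := fun i => bif i then (c : ℂ) * toC (U b) else -(c : ℂ) with hα
    set pt : Bool → Balaban1983to89.Site P j := fun i => bif i then b.tgt else b.src with hpt
    have e1 : Dlin c U (wmul ω φ) b = ∑ i : Bool, α i * ((ω (pt i) : ℂ) * φ (pt i)) := by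
      rw [Dlin_apply, covD_wmul_eq_sum]
      refine Finset.sum_congr rfl fun i _ => ?_
      cases i <;> simp [hα, hpt]
    have e0 : Dlin c U φ b = ∑ i : Bool, α i * φ (pt i) := by
      have h := covD_wmul_eq_sum c U (fun _ => (1 : ℝ)) φ b
      rw [wmul_one'] at h
      rw [Dlin_apply, h]
      refine Finset.sum_congr rfl fun i _ => ?_
      cases i <;> simp [hα, hpt]
    have e2 : Dlin c U (wmul ω (wmul ω φ)) b = ∑ i : Bool, α i * (((ω (pt i) : ℂ)) ^ 2 * φ (pt i)) := by
      rw [wmul_wmul, Dlin_apply, covD_wmul_eq_sum]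
      refine Finset.sum_congr rfl fun i _ => ?_
      cases i <;> simp [hα, hpt, sq, Complex.ofReal_mul, mul_assoc]
    have hωb : ∀ i ∈ (Finset.univ : Finset Bool), ∀ i' ∈ (Finset.univ : Finset Bool),
        (ω (pt i) - ω (pt i')) ^ 2 ≤ S₁ * (ω (pt i) * ω (pt i')) := by
      intro i _ i' _
      cases i <;> cases i'
      · simp only [hpt, cond_false, sub_self]; nlinarith [mul_self_nonneg (ω b.src)]
      · simp only [hpt, cond_false, cond_true]; rw [← neg_sub, neg_sq, mul_comm (ω b.src)]; exact hω b
      · simp only [hpt, cond_false, cond_true]; exact hω b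
      · simp only [hpt, cond_true, sub_self]; nlinarith [mul_self_nonneg (ω b.tgt)]
    have hr := rankOne_defect_le Finset.univ α (fun i => φ (pt i)) (fun i => ω (pt i)) hS₁ hωb
    rw [e1, e0, e2]
    refine hr.trans (le_of_eq ?_)
    have hc : ∀ i, ‖α i‖ = |c| := by
      intro i; cases i
      · simp [hα]
      · simp [hα, norm_toC]
    simp only [hc, Fintype.sum_bool, hpt, cond_true, cond_false]
    rw [← sq_abs c]; ring
  refine (Finset.sum_le_sum fun b _ => hb b).trans (le_of_eq ?_)
  rw [← Finset.mul_sum, Finset.sum_add_distrib, sum_bond_eq, sum_bond_eq]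
  simp only [PBond.tgt]
  rw [sum_sum_shift_dir (fun x => (ω x * ‖φ x‖) ^ 2), sum_sum_dir (fun x => (ω x * ‖φ x‖) ^ 2), ← norm_wmul_sq]
  ring


/-! ## §3 The conjugation defect of the covariant block average -/

/-- kernel: the `k`-level covariant average `(Q_k(u)φ)(y) = N⁻¹Σ_{x∈B^k(y)}u(Γ^{(k)}_{x_k,x})φ(x)` as a rank-one sum over the block.
[cite: BalabanImbrieJaffe1985, (4.6.1) p.313] -/
theorem qCovK_eq_sum_coef {k : ℕ} (U : GaugeField P j U1) (φ : Balaban1983to89.Site P j → ℂ)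
    (y : Balaban1983to89.Site P (j + k)) :
    qCovK U k φ y = ∑ x ∈ blockK k y, (((P.L : ℂ) ^ (k * P.d))⁻¹ * holCK U k x) * φ x := by
  rw [qCovK_apply, Finset.mul_sum]
  exact Finset.sum_congr rfl fun x _ => by ring

/-- kernel: the coefficients have modulus `N⁻¹` and there are `N = L^{kd}` of them: `Σ_{x∈B^k(y)}|α_x| = 1`. [cite: BalabanImbrieJaffe1985, (2.4) p.302] -/
theorem sum_norm_coef {k : ℕ} (hk : j + k ≤ P.m + P.K) (U : GaugeField P j U1) (y : Balaban1983to89.Site P (j + k)) :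
    ∑ x ∈ blockK k y, ‖((P.L : ℂ) ^ (k * P.d))⁻¹ * holCK U k x‖ = 1 := by
  have hN : (0 : ℝ) < (P.L : ℝ) ^ (k * P.d) := pow_pos P.cast_L_pos _
  simp only [norm_mul, norm_inv, norm_pow, Complex.norm_natCast, norm_holCK, mul_one, Finset.sum_const, card_blockK k hk,
    nsmul_eq_mul, Nat.cast_pow]
  exact mul_inv_cancel₀ hN.ne'

/-- **THE CONJUGATION DEFECT OF THE AVERAGING TERM `‖Q_k(u)φ‖²` of (4.6.1)–(4.6.2)** (every `U(1)` field `u`, `j + k ≤ m + K`): if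
`(ω(x) − ω(x′))² ≤ S₂ω(x)ω(x′)` whenever `x, x′` lie in the same `k`-block, then `‖Q_k(u)(ωφ)‖² − ⟨Q_k(u)φ, Q_k(u)(ω²φ)⟩ ≤ (S₂/2)·N⁻¹·‖ωφ‖²`
(`N = L^{kd}`) — §1 per block, blocks partition the torus. [cite: BalabanImbrieJaffe1985, (4.6.2) p.313] -/
theorem defect_Q_le {k : ℕ} (hk : j + k ≤ P.m + P.K) (U : GaugeField P j U1) {ω : Balaban1983to89.Site P j → ℝ} {S₂ : ℝ}
    (hS₂ : 0 ≤ S₂)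
    (hω : ∀ x x' : Balaban1983to89.Site P j, blkIter k x = blkIter k x' → (ω x - ω x') ^ 2 ≤ S₂ * (ω x * ω x'))
    (φ : FineSp P j) :
    ‖QlinK U k (wmul ω φ)‖ ^ 2 - ⟪QlinK U k φ, QlinK U k (wmul ω (wmul ω φ))⟫
      ≤ S₂ / 2 * ((P.L : ℝ) ^ (k * P.d))⁻¹ * ‖wmul ω φ‖ ^ 2 := by
  rw [PiLp.norm_sq_eq_of_L2, inner_eq_re_sum, ← Finset.sum_sub_distrib]
  set α : Balaban1983to89.Site P j → ℂ := fun x => ((P.L : ℂ) ^ (k * P.d))⁻¹ * holCK U k x with hα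
  have hαn : ∀ x, ‖α x‖ = ((P.L : ℝ) ^ (k * P.d))⁻¹ := by
    intro x; simp only [hα, norm_mul, norm_inv, norm_pow, Complex.norm_natCast, norm_holCK, mul_one]
  have hy : ∀ y : Balaban1983to89.Site P (j + k),
      ‖QlinK U k (wmul ω φ) y‖ ^ 2 - (conj (QlinK U k φ y) * QlinK U k (wmul ω (wmul ω φ)) y).re
        ≤ S₂ / 2 * ∑ x ∈ blockK k y, ((P.L : ℝ) ^ (k * P.d))⁻¹ * (ω x * ‖φ x‖) ^ 2 := by
    intro y
    have e1 : QlinK U k (wmul ω φ) y = ∑ x ∈ blockK k y, α x * ((ω x : ℂ) * φ x) := by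
      rw [QlinK_apply, qCovK_eq_sum_coef]; rfl
    have e0 : QlinK U k φ y = ∑ x ∈ blockK k y, α x * φ x := by
      rw [QlinK_apply, qCovK_eq_sum_coef]
    have e2 : QlinK U k (wmul ω (wmul ω φ)) y = ∑ x ∈ blockK k y, α x * (((ω x : ℂ)) ^ 2 * φ x) := by
      rw [wmul_wmul, QlinK_apply, qCovK_eq_sum_coef]
      refine Finset.sum_congr rfl fun x _ => ?_
      simp only [hα, WithLp.ofLp_toLp, wmul, LinearMap.coe_mk, AddHom.coe_mk, Complex.ofReal_mul, sq]
    have hωy : ∀ x ∈ blockK k y, ∀ x' ∈ blockK k y, (ω x - ω x') ^ 2 ≤ S₂ * (ω x * ω x') :=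
      fun x hx x' hx' => hω x x' ((mem_blockK.1 hx).trans (mem_blockK.1 hx').symm)
    have hr := rankOne_defect_le (blockK k y) α (fun x => φ x) ω hS₂ hωy
    rw [e1, e0, e2]
    refine hr.trans (le_of_eq ?_)
    have h1 : (∑ x ∈ blockK k y, ‖α x‖) = 1 := sum_norm_coef hk U y
    rw [h1, mul_one]
    simp only [hαn]
  refine (Finset.sum_le_sum fun y _ => hy y).trans (le_of_eq ?_)
  rw [← Finset.mul_sum, norm_wmul_sq, mul_assoc, Finset.mul_sum (a := ((P.L : ℝ) ^ (k * P.d))⁻¹)]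
  congr 1
  have hfib := Finset.sum_fiberwise (Finset.univ : Finset (Balaban1983to89.Site P j)) (blkIter k)
    (fun x => ((P.L : ℝ) ^ (k * P.d))⁻¹ * (ω x * ‖φ x‖) ^ 2)
  exact hfib

end

end Literature.MathematicalPhysics.QuantumFieldTheory.BalabanImbrieJaffe1984to88.BIJ85AgmonDefect
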